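import Mathlib
import Summits.MatrixMultiplication.MatrixMultiplication.Theses.SnSubsetDichotomy
import Summits.MatrixMultiplication.MatrixMultiplication.Cruxes.PolynomialSlack.IdeaSketchIdeator3

/-!
# Skeleton line `quotient-globalisation-by-pruning` for crux `PolynomialSlack`
(stmt-MatrixMultiplication-8306)

Route `SnSubsetDichotomy`, crux (rank 5)
`PolynomialSlack = ∀ C, ∃ n₀, ∀ n ≥ n₀, ∀ S T U ⊆ S_n with the TPP, |S||T||U| · n^C ≤ (n!)^{3/2}`
(super-polynomial saving for ALL subsets; known for `C < 1/2` only — tree fact `BCGPU2023_thm32`;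
`¬ PolynomialSlack → ThresholdSubsetTriples → ω(ℂ) = 2` by the route's proved `closes`, so this is a
PROOF line on the negative side of the route).

## The line (idea card `Ideas/quotient-globalisation-by-pruning.md`, crux-ideate r1 ideator 3;
triage r1: 3 × pass, common sharpening "restate the transfer C⁺ PAIRWISE", one erratum "the dual
form (3) / C⁺⁺ is false — spread alignment")

OBJECTS (imported BY NAME from `Cruxes/PolynomialSlack/IdeaSketchIdeator3.lean`, so that the shared
identities are filed once): the QUOTIENT SETS `A = S⁻¹T`, `B = T⁻¹U`, `C′ = S⁻¹U` of a triple
(`Finset.image₂ (fun s t => s⁻¹ * t) S T`, …); `IsGlobalWithin H r X` — Keevash–Lifshitz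
(arXiv:2307.15030) Def. 1.6 for sets, RELATIVE to a host `H ⊇ X`:
`|X ∩ U_{I→J}| · |H| ≤ r^{2t} · |X| · |H ∩ U_{I→J}|` for every `t`-umvirate
`U_{I→J} = {σ : σ ∘ I = J}` (`H = univ` is `IsGlobal`, which is EXACTLY KL's `S_n`-normalised `L²`
definition, paper p. 5); `stabFinset L = U_{L→L}`, the pointwise stabiliser `≅ S_{n-|L|}`;
`KL2023ProductMixingLower` — KL Thm. 1.14 (lower half): `A_n` is `0.01`-mixing for `100`-global
`e^{-cn^{1/3}}`-dense products; `TrivialSolutionCount` — the exact count.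

THE MECHANISM.  Under polynomial slack `N := |S||T||U| ≥ (n!)^{3/2} n^{-C}` the quotients are FULL
(`|S⁻¹T| = |S||T|`, the PAIRWISE part of the TPP — `card_quot_first/outer`, proved here) hence
`n^{-2C}`-DENSE in `S_n` (packing `|S||U|, |T||U| ≤ n!` gives `|S||T| ≥ N²/(n!)² ≥ n!·n^{-2C}`), and
the TRIPLE part of the TPP pins the number of solutions of `ab = c′` in `S⁻¹T × T⁻¹U × S⁻¹U` to
EXACTLY `N` (the trivial solutions `(s⁻¹t)(t⁻¹u) = s⁻¹u`; `stub_trivialSolutionCount`), whereas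
product mixing (`stub_klMixing`) demands `≥ 0.99·|A||B||C′|/|A_n| = 1.98·N²/n! ≫ N` solutions as
soon as the three quotients are `100`-global (and even).  Pruning is FREE for this: every sub-triple
of right translates `S′ ⊆ Sα, T′ ⊆ Tβ, U′ ⊆ Uγ` is again TPP (`tpp_image_mul_right` + `.mono`) with
its own exact count.  THE BET of the line (`stub_pairwiseGlobalisation` = `C⁺_pw`, open,
load-bearing): full quotients can always be GLOBALISED BY PRUNING — sub-sets keeping an
`e^{-δn^{1/3}}` fraction of each factor whose three quotients are even and `100`-global INSIDE a
common point stabiliser `Stab_pw(L)`, `2|L| ≤ n`.  The fact transported to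
`Stab_pw(L) ≅ S_{n-|L|}` (`stub_relativeMixing`, provable now) then contradicts the count.
`PolynomialSlack_of` is the kernel-checked arithmetic of the contradiction (`δ := c/8`; thresholds
from `Real.log_le_rpow_div` and `Nat.factorial_mul_pow_le_factorial`; no `sorry`): with
`y = n^{1/3}`, `E = e^{-(c/8)y}`: each pair product is `≥ n!/(n^C)² ≥ e^{-(c/4)y}·n!`
(`pair_lower_aux`), so the pruned quotients have size `≥ E²e^{-(c/4)y}n! = e^{-(c/2)y}n! ≥
e^{-c(n-t)^{1/3}}·|Stab_pw(L)|/2` (as `(n-t)^{1/3} ≥ y/2`); mixing + count give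
`1.98·N′ ≤ |Stab_pw(L)| ≤ n!` for `N′ = |S′||T′||U′| ≥ E³N`, whence
`E³√(n!) < n^C ≤ e^{(c/8)y} = E³e^{(c/2)y} ≤ E³√(n!)` (`e^{cn} ≤ n!`, `y ≤ n`) — absurd.

WHY THIS CUT (triage): (i) `C⁺` is PAIRWISE — as filed by the ideator it carried the TPP + slack and
was implied by the crux (vacuous), i.e. equivalent to it modulo the fact (r1-1, r1-2 (iv),
r1-3 (iv)); `C⁺_pw` mentions no TPP, is non-vacuous (Disproof §2b's rooted matching stabilisers
are pairwise-unique at slack `n³`) and holds there with `t = 1`; (ii) budget `e^{-δn^{1/3}}` for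
EVERY `δ > 0` = the weakest demand the fact tolerates; (iii) only `2t ≤ n` is asked (the mechanism
predicts `t = O(C log n)`); (iv) evenness is asked of the quotients (parity pruning + an odd right
translation give it); (v) the transport is its own provable stub, not an "assembly"; (vi) the
composition's constants are certified by the kernel.

## Disproof used (cdisprove `Disproof.lean` v1–v4, latest 2026-08-15T23:03:47Z, 1423 lines, rc 0,
sorry-free — BODY not mounted in planner/triage jails (`run/gate/evidence/**` absent; `ledger crux
cat … Disproof.lean` → "no crux workfile"); used through its four evidence notes, as the triagers did)
* §2 `polynomialSlack_false_without_TPP` (`S = T = U = S_n`) and `polynomialSlack_false_without_triple'`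
  (TPP weakened to its three PAIRWISE specialisations FAILS at `C = 4`, rooted matching stabilisers)
  — HONOURED, and it organises the cut: the TRIPLE condition is consumed at exactly one place,
  `stub_trivialSolutionCount` (surjectivity onto the solutions of `ab = c′`), applied to the pruned
  translated triple `(S′,T′,U′)`; the pairwise part (full quotients) only FEEDS `C⁺_pw`, which is
  deliberately pairwise and claims no bound by itself — on the §2b witnesses `C⁺_pw` holds and the
  contradiction is absent precisely because their solution count is not `N` (§5: `N_bad ≈ 0.96 ×`
  the mixing prediction — the rooted triple mixes like random sets, as the line predicts).
* §3 (`C ≤ 0` true; Young triples fine), §4 (uniform-in-`C` / fixed-`n` strengthenings false,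
  witness `{1},{1},S_n`) — HONOURED: everything is `∀ C … ∃ n₀ ∀ n ≥ n₀`, `n₀` depends on `C` and `c`.
* §6 `not_exponentialSaving` (exponent `3/2` sharp, `(n!)^{3/2}e^{-O(n)}`) — HONOURED: the line
  claims saving `e^{-Θ(n^{1/3})}` at most (KL density floor, §7 sharpness).
* §1 (`¬crux ⇒ ω = 2`): a refutation of `stub_pairwiseGlobalisation` is NOT one of the crux.
* Landed `Negative/` lemmas for this crux: none (nothing to import). `ledger negatives --problem
  MatrixMultiplication` (2026-08-16): stmt-9732, stmt-9721 (AlgebraicSTPPDichotomy), stmt-8036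
  (DesignFlattening) — none about `S_n`; no stub is an instance of any.
-/

set_option linter.dupNamespace false

open Finset
open Literature.Combinatorics.Additive
open Summit.MatrixMultiplication.MatrixMultiplication.Theses.SnSubsetDichotomy (PolynomialSlack)
open Summit.MatrixMultiplication.MatrixMultiplication.Cruxes.PolynomialSlack.IdeaSketch
  (IsGlobalWithin IsGlobal KL2023ProductMixingLower TrivialSolutionCount stabFinset)

namespace Summit.MatrixMultiplication.MatrixMultiplication.Cruxes.PolynomialSlack.QuotientGlobalisationByPruning

/-! ### TPP algebra used by the composition (proved): rotation, right translation, full quotients -/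

section General

variable {G : Type*} [Group G] [DecidableEq G]

omit [DecidableEq G] in
/-- The TPP is invariant under cyclic rotation of the triple. -/
theorem tpp_rotate {S T U : Finset G} (h : TripleProductProperty S T U) :
    TripleProductProperty T U S := by
  intro t ht t' ht' u hu u' hu' s hs s' hs' he
  have key : s * s'⁻¹ * (t * t'⁻¹) * (u * u'⁻¹) = 1 := by
    have := mul_eq_one_comm.1 he
    simpa only [mul_assoc] using this
  obtain ⟨h1, h2, h3⟩ := h s hs s' hs' t ht t' ht' u hu u' hu' key
  exact ⟨h2, h3, h1⟩

/-- The TPP is invariant under independent right translation of the three sets. -/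
theorem tpp_image_mul_right {S T U : Finset G} (h : TripleProductProperty S T U) (α β γ : G) :
    TripleProductProperty (S.image (· * α)) (T.image (· * β)) (U.image (· * γ)) := by
  intro s hs s' hs' t ht t' ht' u hu u' hu' he
  simp only [Finset.mem_image] at hs hs' ht ht' hu hu'
  obtain ⟨s₀, hs₀, rfl⟩ := hs
  obtain ⟨s₀', hs₀', rfl⟩ := hs'
  obtain ⟨t₀, ht₀, rfl⟩ := ht
  obtain ⟨t₀', ht₀', rfl⟩ := ht'
  obtain ⟨u₀, hu₀, rfl⟩ := hu
  obtain ⟨u₀', hu₀', rfl⟩ := hu'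
  have key : s₀ * s₀'⁻¹ * (t₀ * t₀'⁻¹) * (u₀ * u₀'⁻¹) = 1 := by
    rw [← he]; group
  obtain ⟨h1, h2, h3⟩ := h s₀ hs₀ s₀' hs₀' t₀ ht₀ t₀' ht₀' u₀ hu₀ u₀' hu₀' key
  exact ⟨by rw [h1], by rw [h2], by rw [h3]⟩

/-- Full-size quotient `S⁻¹T` (pairwise uniqueness) from the TPP, third set non-empty. -/
theorem card_quot_first {S T U : Finset G} (h : TripleProductProperty S T U) (hU : U.Nonempty) :
    (Finset.image₂ (fun s t => s⁻¹ * t) S T).card = S.card * T.card := by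
  obtain ⟨u, hu⟩ := hU
  refine Finset.card_image₂_iff.2 ?_
  rintro ⟨s, t⟩ hst ⟨s', t'⟩ hst' he
  simp only [Set.mem_prod, Finset.mem_coe] at hst hst'
  change s⁻¹ * t = s'⁻¹ * t' at he
  have key : s' * s⁻¹ * (t * t'⁻¹) * (u * u⁻¹) = 1 := by
    calc s' * s⁻¹ * (t * t'⁻¹) * (u * u⁻¹) = s' * (s⁻¹ * t) * t'⁻¹ := by group
      _ = s' * (s'⁻¹ * t') * t'⁻¹ := by rw [he]
      _ = 1 := by group
  obtain ⟨h1, h2, -⟩ := h s' hst'.1 s hst.1 t hst.2 t' hst'.2 u hu u hu key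
  exact Prod.ext h1.symm h2

/-- Full-size quotient `S⁻¹U` from the TPP, middle set non-empty. -/
theorem card_quot_outer {S T U : Finset G} (h : TripleProductProperty S T U) (hT : T.Nonempty) :
    (Finset.image₂ (fun s u => s⁻¹ * u) S U).card = S.card * U.card := by
  obtain ⟨t, ht⟩ := hT
  refine Finset.card_image₂_iff.2 ?_
  rintro ⟨s, u⟩ hsu ⟨s', u'⟩ hsu' he
  simp only [Set.mem_prod, Finset.mem_coe] at hsu hsu'
  change s⁻¹ * u = s'⁻¹ * u' at he
  have key : s' * s⁻¹ * (t * t⁻¹) * (u * u'⁻¹) = 1 := by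
    calc s' * s⁻¹ * (t * t⁻¹) * (u * u'⁻¹) = s' * (s⁻¹ * u) * u'⁻¹ := by group
      _ = s' * (s'⁻¹ * u') * u'⁻¹ := by rw [he]
      _ = 1 := by group
  obtain ⟨h1, -, h3⟩ := h s' hsu'.1 s hsu.1 t ht t ht u hsu.2 u' hsu'.2 key
  exact Prod.ext h1.symm h3

end General

/-! ### Two growth lemmas and one squaring step (proved; the composition's arithmetic) -/

/-- `K log n ≤ c n^{1/3}` eventually. -/
theorem growth_log {c : ℝ} (hc : 0 < c) (K : ℝ) (hK : 0 ≤ K) :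
    ∃ n₁ : ℕ, ∀ n : ℕ, n₁ ≤ n → K * Real.log n ≤ c * (n : ℝ) ^ ((1 : ℝ) / 3) := by
  refine ⟨⌈(6 * K / c) ^ 6⌉₊, fun n hn => ?_⟩
  have hn0 : (0 : ℝ) ≤ n := Nat.cast_nonneg n
  have h6 : Real.log n ≤ 6 * (n : ℝ) ^ ((1 : ℝ) / 6) := by
    have := Real.log_le_rpow_div hn0 (by norm_num : (0:ℝ) < 1/6)
    calc Real.log n ≤ (n : ℝ) ^ ((1 : ℝ) / 6) / (1 / 6) := this
      _ = 6 * (n : ℝ) ^ ((1 : ℝ) / 6) := by ring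
  have hy : 6 * K / c ≤ (n : ℝ) ^ ((1 : ℝ) / 6) := by
    have h1 : (6 * K / c) ^ 6 ≤ (n : ℝ) := (Nat.le_ceil _).trans (by exact_mod_cast hn)
    have h2 : 0 ≤ 6 * K / c := by positivity
    calc 6 * K / c = ((6 * K / c) ^ 6) ^ ((6 : ℕ) : ℝ)⁻¹ := (Real.pow_rpow_inv_natCast h2 (by norm_num)).symm
      _ ≤ (n : ℝ) ^ ((6 : ℕ) : ℝ)⁻¹ := Real.rpow_le_rpow (by positivity) h1 (by positivity)
      _ = (n : ℝ) ^ ((1 : ℝ) / 6) := by norm_num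
  have hsplit : (n : ℝ) ^ ((1 : ℝ) / 3) = (n : ℝ) ^ ((1 : ℝ) / 6) * (n : ℝ) ^ ((1 : ℝ) / 6) := by
    rw [← Real.rpow_add_of_nonneg hn0 (by norm_num) (by norm_num)]; norm_num
  have hy0 : 0 ≤ (n : ℝ) ^ ((1 : ℝ) / 6) := Real.rpow_nonneg hn0 _
  calc K * Real.log n ≤ K * (6 * (n : ℝ) ^ ((1 : ℝ) / 6)) := mul_le_mul_of_nonneg_left h6 hK
    _ = (6 * K / c) * (n : ℝ) ^ ((1 : ℝ) / 6) * c := by field_simp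
    _ ≤ (n : ℝ) ^ ((1 : ℝ) / 6) * (n : ℝ) ^ ((1 : ℝ) / 6) * c := by gcongr
    _ = c * (n : ℝ) ^ ((1 : ℝ) / 3) := by rw [hsplit]; ring

/-- `e^{Kn} ≤ n!` eventually. -/
theorem growth_factorial (K : ℝ) (hK : 0 ≤ K) :
    ∃ n₃ : ℕ, ∀ n : ℕ, n₃ ≤ n → Real.exp (K * n) ≤ (n.factorial : ℝ) := by
  obtain ⟨M, hM⟩ : ∃ M : ℕ, Real.exp (2 * K) ≤ (M : ℝ) + 1 :=
    ⟨⌈Real.exp (2 * K)⌉₊, (Nat.le_ceil _).trans (le_add_of_nonneg_right zero_le_one)⟩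
  refine ⟨2 * M, fun n hn => ?_⟩
  obtain ⟨k, rfl⟩ : ∃ k, n = M + k := ⟨n - M, by omega⟩
  have hfac : (((M + 1) ^ k : ℕ) : ℝ) ≤ ((M + k).factorial : ℝ) := by
    have h' : (M + 1) ^ k ≤ (M + k).factorial :=
      le_trans (Nat.le_mul_of_pos_left _ (Nat.factorial_pos M)) Nat.factorial_mul_pow_le_factorial
    exact_mod_cast h'
  calc Real.exp (K * ((M + k : ℕ) : ℝ)) ≤ Real.exp ((k : ℕ) * (2 * K)) := by
        apply Real.exp_le_exp.2
        have hk : (M : ℝ) ≤ k := by exact_mod_cast (show M ≤ k by omega)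
        push_cast
        nlinarith
    _ = (Real.exp (2 * K)) ^ k := Real.exp_nat_mul _ _
    _ ≤ ((M : ℝ) + 1) ^ k := by gcongr
    _ = (((M + 1) ^ k : ℕ) : ℝ) := by push_cast; ring
    _ ≤ ((M + k).factorial : ℝ) := hfac


/-- Squaring-and-packing step: if `a√a < X`, `X² = P·(Q·R)·w` with `Q, R ≤ a`, then `a ≤ P·w`. -/
theorem pair_lower_aux {a w P Q R X : ℝ} (ha : 0 < a) (hP : 0 ≤ P) (hR : 0 ≤ R)
    (hw : 0 ≤ w) (hQa : Q ≤ a) (hRa : R ≤ a) (hlt : a * Real.sqrt a < X)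
    (hX : X ^ 2 = P * (Q * R) * w) : a ≤ P * w := by
  have h2 : (a * Real.sqrt a) ^ 2 < X ^ 2 := pow_lt_pow_left₀ hlt (by positivity) two_ne_zero
  rw [mul_pow, Real.sq_sqrt ha.le, hX] at h2
  have h3 : P * (Q * R) * w ≤ P * (a * a) * w := by gcongr
  by_contra hcon
  rw [not_le] at hcon
  have h4 : P * (a * a) * w < a ^ 2 * a := by
    calc P * (a * a) * w = (P * w) * (a * a) := by ring
      _ < a * (a * a) := by gcongr
      _ = a ^ 2 * a := by ring
  linarith


/-! ### The four stub STATEMENTS (named `Prop`s; the registered `stub_*` theorems below restate them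
verbatim, and `Registered.stub_*` are their name-keyed aliases used as the hypotheses of
`PolynomialSlack_of` — same device as `Cruxes/NoThresholdSubsetTriple/Lines/sidon-regime-hereditary-density.lean`) -/

/-- Statement of STUB 2 — PRODUCT MIXING RELATIVE TO A POINT STABILISER: the Keevash–Lifshitz
statement `KL2023ProductMixingLower` transported along `Stab_pw(L) ≅ S_{n-t}` (`L : Fin t ↪ Fin n`):
for `n - t ≥ m₀`, three sets of EVEN permutations inside `Stab_pw(L)` that are `100`-global WITHIN
`Stab_pw(L)` and have at least `e^{-c(n-t)^{1/3}} · |Stab_pw(L)|/2` elements satisfy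
`#{(a,b) ∈ A × B : ab ∈ C} ≥ 0.99 · |A||B||C| / (|Stab_pw(L)|/2)`.  With `t = 0` it is the fact itself. -/
def RelativeMixingLower : Prop :=
  ∃ c : ℝ, 0 < c ∧ ∃ m₀ : ℕ, ∀ (n t : ℕ) (L : Fin t → Fin n), Function.Injective L → m₀ + t ≤ n →
    ∀ A B C : Finset (Equiv.Perm (Fin n)),
    (∀ σ ∈ A, Equiv.Perm.sign σ = 1) → (∀ σ ∈ B, Equiv.Perm.sign σ = 1) →
    (∀ σ ∈ C, Equiv.Perm.sign σ = 1) →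
    IsGlobalWithin (stabFinset L) 100 A → IsGlobalWithin (stabFinset L) 100 B →
    IsGlobalWithin (stabFinset L) 100 C →
    Real.exp (-(c * ((n - t : ℕ) : ℝ) ^ ((1 : ℝ) / 3))) * (((stabFinset L).card : ℝ) / 2) ≤ (A.card : ℝ) →
    Real.exp (-(c * ((n - t : ℕ) : ℝ) ^ ((1 : ℝ) / 3))) * (((stabFinset L).card : ℝ) / 2) ≤ (B.card : ℝ) →
    Real.exp (-(c * ((n - t : ℕ) : ℝ) ^ ((1 : ℝ) / 3))) * (((stabFinset L).card : ℝ) / 2) ≤ (C.card : ℝ) →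
    0.99 * ((A.card : ℝ) * (B.card : ℝ) * (C.card : ℝ)) / (((stabFinset L).card : ℝ) / 2) ≤
      (((A ×ˢ B).filter (fun ab => ab.1 * ab.2 ∈ C)).card : ℝ)

/-- Statement of STUB 4 — `C⁺_pw`, GLOBALISATION BY PRUNING, PAIRWISE FORM (the line's transfer and
its load-bearing bet; triage r1 sharpening: NO triple condition among the hypotheses).  For all `C`
and every budget rate `δ > 0`, eventually in `n`: if `S, T, U ⊆ S_n` have FULL QUOTIENTS
(`|S⁻¹T| = |S||T|`, `|T⁻¹U| = |T||U|`, `|S⁻¹U| = |S||U|`) and polynomial slack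
`(n!)^{3/2} ≤ |S||T||U| · n^C`, then there are `t` with `2t ≤ n`, an injective `L : Fin t → Fin n`,
right translations `α β γ` and sub-sets `S′ ⊆ Sα`, `T′ ⊆ Tβ`, `U′ ⊆ Uγ` keeping
`|X′| ≥ e^{-δ n^{1/3}} |X|`, whose three quotients `S′⁻¹T′, T′⁻¹U′, S′⁻¹U′` consist of even
permutations and are `100`-global WITHIN `Stab_pw(L)` (`IsGlobalWithin (stabFinset L) 100`). -/
def PairwiseGlobalisation : Prop :=
  ∀ C δ : ℝ, 0 < δ → ∃ n₀ : ℕ, ∀ n ≥ n₀, ∀ S T U : Finset (Equiv.Perm (Fin n)),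
    (Finset.image₂ (fun s t => s⁻¹ * t) S T).card = S.card * T.card →
    (Finset.image₂ (fun t u => t⁻¹ * u) T U).card = T.card * U.card →
    (Finset.image₂ (fun s u => s⁻¹ * u) S U).card = S.card * U.card →
    (n.factorial : ℝ) ^ ((3 : ℝ) / 2) ≤ ((S.card * T.card * U.card : ℕ) : ℝ) * (n : ℝ) ^ C →
    ∃ (t : ℕ) (L : Fin t → Fin n) (α β γ : Equiv.Perm (Fin n)) (S' T' U' : Finset (Equiv.Perm (Fin n))),
      2 * t ≤ n ∧ Function.Injective L ∧
      S' ⊆ S.image (· * α) ∧ T' ⊆ T.image (· * β) ∧ U' ⊆ U.image (· * γ) ∧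
      Real.exp (-(δ * (n : ℝ) ^ ((1 : ℝ) / 3))) * (S.card : ℝ) ≤ (S'.card : ℝ) ∧
      Real.exp (-(δ * (n : ℝ) ^ ((1 : ℝ) / 3))) * (T.card : ℝ) ≤ (T'.card : ℝ) ∧
      Real.exp (-(δ * (n : ℝ) ^ ((1 : ℝ) / 3))) * (U.card : ℝ) ≤ (U'.card : ℝ) ∧
      (∀ σ ∈ Finset.image₂ (fun s t => s⁻¹ * t) S' T', Equiv.Perm.sign σ = 1) ∧
      (∀ σ ∈ Finset.image₂ (fun t u => t⁻¹ * u) T' U', Equiv.Perm.sign σ = 1) ∧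
      (∀ σ ∈ Finset.image₂ (fun s u => s⁻¹ * u) S' U', Equiv.Perm.sign σ = 1) ∧
      IsGlobalWithin (stabFinset L) 100 (Finset.image₂ (fun s t => s⁻¹ * t) S' T') ∧
      IsGlobalWithin (stabFinset L) 100 (Finset.image₂ (fun t u => t⁻¹ * u) T' U') ∧
      IsGlobalWithin (stabFinset L) 100 (Finset.image₂ (fun s u => s⁻¹ * u) S' U')

/-! ### The registered stubs (`sorry` lives only here) -/

/-- STUB 1 (KNOWN THEOREM, named-fact flavour; XL to formalise, 0 lines to vendor) —
`KL2023ProductMixingLower`, verbatim: Keevash–Lifshitz, *Sharp hypercontractivity for symmetric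
groups and its applications*, arXiv:2307.15030, **Thm. 1.14** with Def. 1.6 (globalness, `S_n`-normalised
`L²`, p. 5 lines 1–9 of the held text) and Def. 1.13 (ε-mixing for products, p. 6 lines 82–110):
"The alternating group `A_n` is `0.01`-mixing for `100`-global `e^{-cn^{1/3}}`-dense products, for
some absolute constant `c > 0`" — i.e. for `A, B, C ⊆ A_n` `100`-global of densities `≥ e^{-cn^{1/3}}`
in `A_n`, `#{(a,b) ∈ A × B : ab ∈ C} ≥ 0.99 · |A||B||C|/|A_n|` (lower half; the transcription is
slightly WEAKER than print: closed interval, `∃ n₀`).  To be VENDORED as a Literature named fact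
(cite KeevashLifshitz2023 Thm 1.14) and used as a hypothesis; its proof (level-`d` inequality Thm 1.8,
spectral bound Thm 1.9, Thm 4.1 for biglobal functions) is not proposed for formalisation.
Why it might fail: only by mis-transcription (checked by three triage seats and this one). -/
theorem stub_klMixing :
    ∃ c : ℝ, 0 < c ∧ ∃ n₀ : ℕ, ∀ n ≥ n₀, ∀ A B C : Finset (Equiv.Perm (Fin n)),
      (∀ σ ∈ A, Equiv.Perm.sign σ = 1) → (∀ σ ∈ B, Equiv.Perm.sign σ = 1) →
      (∀ σ ∈ C, Equiv.Perm.sign σ = 1) →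
      IsGlobal 100 A → IsGlobal 100 B → IsGlobal 100 C →
      Real.exp (-(c * (n : ℝ) ^ ((1 : ℝ) / 3))) * ((n.factorial : ℝ) / 2) ≤ (A.card : ℝ) →
      Real.exp (-(c * (n : ℝ) ^ ((1 : ℝ) / 3))) * ((n.factorial : ℝ) / 2) ≤ (B.card : ℝ) →
      Real.exp (-(c * (n : ℝ) ^ ((1 : ℝ) / 3))) * ((n.factorial : ℝ) / 2) ≤ (C.card : ℝ) →
      0.99 * ((A.card : ℝ) * (B.card : ℝ) * (C.card : ℝ)) / ((n.factorial : ℝ) / 2) ≤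
        (((A ×ˢ B).filter (fun ab => ab.1 * ab.2 ∈ C)).card : ℝ) := by
  sorry

/-- STUB 2 (M/L, PROVABLE NOW) — THE TRANSPORT `Stab_pw(L) ≅ S_{n-t}`:
`KL2023ProductMixingLower → RelativeMixingLower`.
Proof route: given the fact's `(c, n₀)` take the same `c` and `m₀ := n₀`.  For injective
`L : Fin t → Fin n` let `p x := x ∉ Set.range L`, `m := n - t = Fintype.card {x // p x}`, and
`e : {x // p x} ≃ Fin m` (`Fintype.equivFinOfCardEq`).  Every `σ ∈ stabFinset L` preserves `p`
(it fixes `range L` pointwise), so `φ σ := (e.symm.trans (σ.subtypePerm _)).trans e`, i.e.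
`e.permCongr (σ.subtypePerm _)`, is a permutation of `Fin m`; `φ` is multiplicative and injective on
`Stab_pw(L)` and surjective onto `Perm (Fin m)` (extend by the identity on `range L`:
`Equiv.Perm.ofSubtype`), so `|stabFinset L| = m!`.  It preserves signs
(`Equiv.Perm.sign_subtypePerm` — the moved points satisfy `p` — and `Equiv.Perm.sign_permCongr`),
cardinalities of `A, B, C` and of the solution set `{(a,b) : ab ∈ C}` (`Finset.card_image_of_injOn`),
and UMVIRATES: for injective `I″ J″ : Fin t′ → Fin m` put `I := (↑) ∘ e.symm ∘ I″`, `J` likewise; then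
`σ ∈ U_{I→J} ↔ φ σ ∈ U_{I″→J″}` for `σ ∈ Stab_pw(L)` and `|stabFinset L ∩ U_{I→J}| = (m - t′)! =
|U_{I″→J″}|`, so `IsGlobalWithin (stabFinset L) 100 A` (which quantifies over MORE umvirates than
those) gives `IsGlobal 100 (φ '' A)` in `S_m`; the density hypothesis is literally the fact's
(`|stabFinset L| = m!`, exponent `(n - t : ℕ)`), and `m ≥ m₀`.  Apply the fact in `S_m` and transport
the conclusion back.  Size M/L (~250 lines of `Equiv`/`Finset.card` bookkeeping; the route support
`UmvirateDescent` stmt-8308 is the same transport for bare cardinalities).  Leans on: Mathlib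
`Equiv.Perm.subtypePerm`, `Equiv.Perm.ofSubtype`, `Equiv.permCongr`, `Equiv.Perm.sign_subtypePerm`,
`Equiv.Perm.sign_permCongr`, `Fintype.card_perm`, `Fintype.equivFinOfCardEq`,
`Finset.card_image_of_injOn`; tree `IsGlobalWithin`, `stabFinset`.
Why it might fail: it cannot (pure transport); the only trap is the umvirate direction, which goes
the right way (within-globalness ⇒ globalness of the image). -/
theorem stub_relativeMixing :
    (∃ c : ℝ, 0 < c ∧ ∃ n₀ : ℕ, ∀ n ≥ n₀, ∀ A B C : Finset (Equiv.Perm (Fin n)),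
    (∀ σ ∈ A, Equiv.Perm.sign σ = 1) → (∀ σ ∈ B, Equiv.Perm.sign σ = 1) →
    (∀ σ ∈ C, Equiv.Perm.sign σ = 1) →
    IsGlobal 100 A → IsGlobal 100 B → IsGlobal 100 C →
    Real.exp (-(c * (n : ℝ) ^ ((1 : ℝ) / 3))) * ((n.factorial : ℝ) / 2) ≤ (A.card : ℝ) →
    Real.exp (-(c * (n : ℝ) ^ ((1 : ℝ) / 3))) * ((n.factorial : ℝ) / 2) ≤ (B.card : ℝ) →
    Real.exp (-(c * (n : ℝ) ^ ((1 : ℝ) / 3))) * ((n.factorial : ℝ) / 2) ≤ (C.card : ℝ) →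
    0.99 * ((A.card : ℝ) * (B.card : ℝ) * (C.card : ℝ)) / ((n.factorial : ℝ) / 2) ≤
    (((A ×ˢ B).filter (fun ab => ab.1 * ab.2 ∈ C)).card : ℝ)) →
    ∃ c : ℝ, 0 < c ∧ ∃ m₀ : ℕ, ∀ (n t : ℕ) (L : Fin t → Fin n), Function.Injective L → m₀ + t ≤ n →
    ∀ A B C : Finset (Equiv.Perm (Fin n)),
    (∀ σ ∈ A, Equiv.Perm.sign σ = 1) → (∀ σ ∈ B, Equiv.Perm.sign σ = 1) →
    (∀ σ ∈ C, Equiv.Perm.sign σ = 1) →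
    IsGlobalWithin (stabFinset L) 100 A → IsGlobalWithin (stabFinset L) 100 B →
    IsGlobalWithin (stabFinset L) 100 C →
    Real.exp (-(c * ((n - t : ℕ) : ℝ) ^ ((1 : ℝ) / 3))) * (((stabFinset L).card : ℝ) / 2) ≤ (A.card : ℝ) →
    Real.exp (-(c * ((n - t : ℕ) : ℝ) ^ ((1 : ℝ) / 3))) * (((stabFinset L).card : ℝ) / 2) ≤ (B.card : ℝ) →
    Real.exp (-(c * ((n - t : ℕ) : ℝ) ^ ((1 : ℝ) / 3))) * (((stabFinset L).card : ℝ) / 2) ≤ (C.card : ℝ) →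
    0.99 * ((A.card : ℝ) * (B.card : ℝ) * (C.card : ℝ)) / (((stabFinset L).card : ℝ) / 2) ≤
      (((A ×ˢ B).filter (fun ab => ab.1 * ab.2 ∈ C)).card : ℝ) := by
  sorry

/-- STUB 3 (M, PROVABLE NOW — a candidate proof EXISTS) — THE EXACT COUNT, verbatim
`TrivialSolutionCount` of `IdeaSketchIdeator3` (dense form of route support `QuotientSetDeficit`
stmt-8307; the coupling of sibling line `transport-split-hull` — ONE shared identity, triage r1-2/3):
for a TPP triple the solutions of `ab = c′` in `S⁻¹T × T⁻¹U × S⁻¹U` are exactly the `|S||T||U|`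
trivial ones.  Proof route: `(s⁻¹t)(t′⁻¹u) = s″⁻¹u″ ⇒ s″s⁻¹ · (t t′⁻¹) · (u u″⁻¹) = 1 ⇒ s″ = s,
t = t′, u = u″` by the TRIPLE condition (tree convention of `TripleProductProperty`) — this is THE
place where the line uses the genuine three-fold TPP (Disproof §2 `false_without_triple'`); and
`(s,t,u) ↦ (s⁻¹t, t⁻¹u)` is injective by the pairwise part (witness `u`); empty sets give `0 = 0`.
The r1-3 triager's `Transport.lean` (evidence on stmt-MatrixMultiplication-8306, 2026-08-16T01:12:52Z,
rc 0, 0 sorry) proves exactly this statement as `trivialSolutionCount_holds`; land it with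
`--supports stmt-MatrixMultiplication-8306`.  Leans on: `Finset.card_image₂_iff`, `Finset.card_nbij`,
`TripleProductProperty`. -/
theorem stub_trivialSolutionCount :
    ∀ (n : ℕ) (S T U : Finset (Equiv.Perm (Fin n))), TripleProductProperty S T U →
      ((Finset.image₂ (fun s t => s⁻¹ * t) S T ×ˢ Finset.image₂ (fun t u => t⁻¹ * u) T U).filter
          (fun ab => ab.1 * ab.2 ∈ Finset.image₂ (fun s u => s⁻¹ * u) S U)).card =
        S.card * T.card * U.card := by
  sorry

/-- STUB 4 (XL, OPEN — the line's TRANSFER `C⁺_pw` and its LOAD-BEARING bet, HARDEST) —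
`PairwiseGlobalisation`, verbatim (see the statement's docstring for the reading).
Why plausibly true: (a) non-vacuous and TRUE on every pairwise-unique poly-slack family on record —
Disproof §2b's rooted matching stabilisers `K_a = C(μ_a) ∩ Stab(0)` (`a = 1,3,5`; `|K|³ =
(n!)^{3/2}(πn/2)^{3/4}n^{-3}`): `t = 1`, `L = (0)`, no pruning, inside `Stab(0)` the quotients
`K_a⁻¹K_b` are `1.08–1.24`-global at levels `≤ 3` (ideator's exact orbital computation `m ≤ 9`;
re-test kit j008663 pending) and of density `≈ 1.25/√n`, so no level can exceed factor `√n ≪ 10⁴`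
before `n > 10⁸`; common-root coset pairs likewise (one descent step); (b) the DIAGONAL case of the
density increment is affordable: by the alignment identity `|S⁻¹T ∩ U_{I→J}| = Σ_L |S ∩ U_{J→L}| ·
|T ∩ U_{I→L}|` (pairwise uniqueness), a quotient bump carried by ONE common target `L` is removed
by restricting `S` to `U_{J→L}`, `T` to `U_{I→L}` (and the third factor to its best `U_{P→L}`) and
descending, multiplying that quotient's density by `≥ 10^{4t}` at cost `≥ n^{-t}` per factor; at
density `≥ n^{-2C}` at most `O(C log n)` unit levels occur, total loss `e^{-O(C log² n)} ≫
e^{-δn^{1/3}}`; (c) near-threshold hosts cannot afford deep alignment: a factor of relative density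
`≥ n^{-C-a}` in a host with near-uniform `K′`-point statistics (e.g. `B(M)`, rooted stabilisers,
`|H| ≤ √(n!)n^a`) can be range-aligned on at most `K′ ≤ (C+a)/(1-β) = O(1)` coordinates of block
width `n^β` — removable by `O(1)` descent steps at polynomial cost.
Why it might fail / what is open: SPREAD ALIGNMENT (triage r1-2 §D, r1-3 remark (2), replacing the
ideator's erroneous dual-form claim): if the correlation `Σ_L p_S(J→L)p_T(I→L)` is spread over
`≈ n^{(t)}/β` sources (range-aligned boxes `s(j_k), t(i_k) ∈ W_k`, `|W_k| = n^β`, `½ < β < 1`, on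
`K′ ≫ n^{1/3}/log n` coordinates), the quotient is `(n^{1-β})^{K′}`-non-global while all factor
bumps are sub-neutral, one descent step captures a single term and the density DROPS, and
un-aligning costs `e^{-βK′log n}` — beyond budget.  Whether such a pair can have FULL quotients at
sizes `≥ √(n!)n^{-C}` is unknown (random dense subsets of two aligned boxes never do:
`E|SS⁻¹ ∩ TT⁻¹| ≈ n!n^{-4C} ≫ 1`; collapsed-difference-set hosts of size `√(n!)·poly` cannot afford
the alignment by (c)); it is the ideator's cheapest falsifier (2), UNRUN (kit, `n = 16–20`).  Two
design problems for the prover: THREE quotients at once (a diagonal step on `(S,T)` restricts `U`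
too and can lower the density/globalness of `T⁻¹U`, `S⁻¹U`: the product of the three quotient
densities is not a monotone potential — an order of operations or a finer potential is needed) and
degradation of globalness constants under restriction (KL Lemma 1.1 / §6 Step 1 relative notions).
A refutation of this stub does NOT refute the crux (pairwise statement; Disproof §1 is not
triggered) — it sends the line to a TPP-using pruning.  Sources: arXiv:2307.15030 (Lemma 1.1, §6
Step 1, §7), arXiv:2205.15191, doi:10.19086/da.610, BlasiakChurchCohnGrochowUmans2017 §5, route file
§ Numbers (neutral scale `n^{t/2}`), Disproof §2b/§5, TRIAGE-r1-2 §D, TRIAGE-r1-3 §B. -/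
theorem stub_pairwiseGlobalisation :
    ∀ C δ : ℝ, 0 < δ → ∃ n₀ : ℕ, ∀ n ≥ n₀, ∀ S T U : Finset (Equiv.Perm (Fin n)),
    (Finset.image₂ (fun s t => s⁻¹ * t) S T).card = S.card * T.card →
    (Finset.image₂ (fun t u => t⁻¹ * u) T U).card = T.card * U.card →
    (Finset.image₂ (fun s u => s⁻¹ * u) S U).card = S.card * U.card →
    (n.factorial : ℝ) ^ ((3 : ℝ) / 2) ≤ ((S.card * T.card * U.card : ℕ) : ℝ) * (n : ℝ) ^ C →
    ∃ (t : ℕ) (L : Fin t → Fin n) (α β γ : Equiv.Perm (Fin n)) (S' T' U' : Finset (Equiv.Perm (Fin n))),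
      2 * t ≤ n ∧ Function.Injective L ∧
      S' ⊆ S.image (· * α) ∧ T' ⊆ T.image (· * β) ∧ U' ⊆ U.image (· * γ) ∧
      Real.exp (-(δ * (n : ℝ) ^ ((1 : ℝ) / 3))) * (S.card : ℝ) ≤ (S'.card : ℝ) ∧
      Real.exp (-(δ * (n : ℝ) ^ ((1 : ℝ) / 3))) * (T.card : ℝ) ≤ (T'.card : ℝ) ∧
      Real.exp (-(δ * (n : ℝ) ^ ((1 : ℝ) / 3))) * (U.card : ℝ) ≤ (U'.card : ℝ) ∧
      (∀ σ ∈ Finset.image₂ (fun s t => s⁻¹ * t) S' T', Equiv.Perm.sign σ = 1) ∧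
      (∀ σ ∈ Finset.image₂ (fun t u => t⁻¹ * u) T' U', Equiv.Perm.sign σ = 1) ∧
      (∀ σ ∈ Finset.image₂ (fun s u => s⁻¹ * u) S' U', Equiv.Perm.sign σ = 1) ∧
      IsGlobalWithin (stabFinset L) 100 (Finset.image₂ (fun s t => s⁻¹ * t) S' T') ∧
      IsGlobalWithin (stabFinset L) 100 (Finset.image₂ (fun t u => t⁻¹ * u) T' U') ∧
      IsGlobalWithin (stabFinset L) 100 (Finset.image₂ (fun s u => s⁻¹ * u) S' U') := by
  sorry

/-! ### Consistency: each named statement IS its registered stub (definitionally) -/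

theorem klMixing_holds : KL2023ProductMixingLower := stub_klMixing
theorem relativeMixingLower_holds : RelativeMixingLower := stub_relativeMixing stub_klMixing
theorem trivialSolutionCount_holds : TrivialSolutionCount := stub_trivialSolutionCount
theorem pairwiseGlobalisation_holds : PairwiseGlobalisation := stub_pairwiseGlobalisation
example : KL2023ProductMixingLower → RelativeMixingLower := stub_relativeMixing

/-! ### Name-keyed aliases of the four statements (the hypotheses of the composition) -/
namespace Registered

/-- Alias of `KL2023ProductMixingLower` keyed by the registered stub name. -/
abbrev stub_klMixing : Prop := KL2023ProductMixingLower
/-- Alias of the transport `KL2023ProductMixingLower → RelativeMixingLower`. -/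
abbrev stub_relativeMixing : Prop := KL2023ProductMixingLower → RelativeMixingLower
/-- Alias of `TrivialSolutionCount`. -/
abbrev stub_trivialSolutionCount : Prop := TrivialSolutionCount
/-- Alias of `PairwiseGlobalisation` (`C⁺_pw`). -/
abbrev stub_pairwiseGlobalisation : Prop := PairwiseGlobalisation

end Registered

/-! ### Small facts about the host `Stab_pw(L)` -/

theorem card_stabFinset_le {n t : ℕ} (L : Fin t → Fin n) : (stabFinset L).card ≤ n.factorial := by
  calc (stabFinset L).card ≤ (Finset.univ : Finset (Equiv.Perm (Fin n))).card :=
        Finset.card_filter_le _ _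
    _ = n.factorial := by rw [Finset.card_univ, Fintype.card_perm, Fintype.card_fin]

theorem card_stabFinset_pos {n t : ℕ} (L : Fin t → Fin n) : 0 < (stabFinset L).card :=
  Finset.card_pos.2 ⟨1, by simp [stabFinset]⟩

/-! ### The composition: the four stubs imply the crux, BY NAME (kernel-checked, no `sorry`) -/

set_option maxHeartbeats 800000 in
/-- **`PolynomialSlack_of`** — `stub_klMixing → stub_relativeMixing → stub_trivialSolutionCount →
stub_pairwiseGlobalisation → PolynomialSlack`.  Given `C`: `(c, m₀)` from the relative fact,
`n₁` with `max(C,0)·log n ≤ (c/8)·n^{1/3}` (`growth_log`), `n₃` with `e^{cn} ≤ n!`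
(`growth_factorial`), `n₄ = n₀(C, δ := c/8)` of `C⁺_pw`; `n₀ := n₁ + n₃ + n₄ + 2m₀ + 2`.  For a TPP
triple violating the bound: all three sets are non-empty, the quotients are full (pairwise TPP) and
packed (`≤ n!`); `C⁺_pw` prunes/translates/descends; the new triple is TPP (`tpp_image_mul_right`,
`.mono`), so its quotients are full and its count exact (STUB 3); the density thresholds inside
`Stab_pw(L)` are met (`pair_lower_aux`, `(n-t)^{1/3} ≥ n^{1/3}/2`); STUB 2 gives
`1.98 N′ ≤ |Stab_pw(L)| ≤ n!`; budgets give `N′ ≥ E³N`; and `E³√(n!) < n^C ≤ E³√(n!)`. -/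
theorem PolynomialSlack_of (h₁ : Registered.stub_klMixing) (h₂ : Registered.stub_relativeMixing)
    (h₃ : Registered.stub_trivialSolutionCount) (h₄ : Registered.stub_pairwiseGlobalisation) :
    Summit.MatrixMultiplication.MatrixMultiplication.Theses.SnSubsetDichotomy.PolynomialSlack := by
  obtain ⟨c, hc, m₀, hmix⟩ := h₂ h₁
  intro C
  obtain ⟨n₁, hn₁⟩ := growth_log (c := c / 8) (by positivity) (max C 0) (le_max_right _ _)
  obtain ⟨n₃, hn₃⟩ := growth_factorial c hc.le
  obtain ⟨n₄, hn₄⟩ := h₄ C (c / 8) (by positivity)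
  refine ⟨n₁ + n₃ + n₄ + 2 * m₀ + 2, fun n hn S T U hTPP => ?_⟩
  by_contra hlt
  rw [not_le] at hlt
  -- basic positivity
  have hF0 : (0 : ℝ) < n.factorial := by exact_mod_cast n.factorial_pos
  have hn1 : (1 : ℝ) ≤ n := by exact_mod_cast (show 1 ≤ n by omega)
  have hn0 : (0 : ℝ) ≤ n := by linarith
  have hnC : 0 < (n : ℝ) ^ C := Real.rpow_pos_of_pos (by linarith) C
  -- N > 0 and the sets are non-empty
  have hNpos : 0 < ((S.card * T.card * U.card : ℕ) : ℝ) := by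
    by_contra h0
    rw [not_lt] at h0
    have : ((S.card * T.card * U.card : ℕ) : ℝ) * (n : ℝ) ^ C ≤ 0 :=
      mul_nonpos_of_nonpos_of_nonneg h0 hnC.le
    linarith [Real.rpow_pos_of_pos hF0 ((3 : ℝ) / 2)]
  have hN0 : S.card * T.card * U.card ≠ 0 := by exact_mod_cast hNpos.ne'
  have hS0 : S.card ≠ 0 := fun h => hN0 (by simp [h])
  have hT0 : T.card ≠ 0 := fun h => hN0 (by simp [h])
  have hU0 : U.card ≠ 0 := fun h => hN0 (by simp [h])
  have hSne : S.Nonempty := Finset.card_pos.1 (Nat.pos_of_ne_zero hS0)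
  have hTne : T.Nonempty := Finset.card_pos.1 (Nat.pos_of_ne_zero hT0)
  have hUne : U.Nonempty := Finset.card_pos.1 (Nat.pos_of_ne_zero hU0)
  have hScast : (0 : ℝ) < S.card := by exact_mod_cast Nat.pos_of_ne_zero hS0
  have hTcast : (0 : ℝ) < T.card := by exact_mod_cast Nat.pos_of_ne_zero hT0
  have hUcast : (0 : ℝ) < U.card := by exact_mod_cast Nat.pos_of_ne_zero hU0
  -- full quotients of (S, T, U): the pairwise part of the TPP
  have hqST := card_quot_first hTPP hUne
  have hqTU : (Finset.image₂ (fun t u => t⁻¹ * u) T U).card = T.card * U.card :=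
    card_quot_first (tpp_rotate hTPP) hSne
  have hqSU := card_quot_outer hTPP hTne
  -- packing: each pair product is at most n!
  have hpack : ∀ X Y : Finset (Equiv.Perm (Fin n)),
      (Finset.image₂ (fun s t => s⁻¹ * t) X Y).card = X.card * Y.card →
      (X.card : ℝ) * (Y.card : ℝ) ≤ n.factorial := by
    intro X Y hXY
    have : X.card * Y.card ≤ n.factorial := by
      rw [← hXY]
      calc _ ≤ (Finset.univ : Finset (Equiv.Perm (Fin n))).card := Finset.card_le_univ _
        _ = n.factorial := by rw [Finset.card_univ, Fintype.card_perm, Fintype.card_fin]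
    exact_mod_cast this
  have hpST := hpack S T hqST
  have hpTU := hpack T U hqTU
  have hpSU := hpack S U hqSU
  -- C⁺: prune, translate, descend
  obtain ⟨t, L, α, β, γ, S', T', U', h2t, hL, hS', hT', hU', hbS, hbT, hbU, heST, heTU, heSU,
    hgST, hgTU, hgSU⟩ := hn₄ n (by omega) S T U hqST hqTU hqSU hlt.le
  clear hn₄
  have hTPP' : TripleProductProperty S' T' U' :=
    (tpp_image_mul_right hTPP α β γ).mono hS' hT' hU'
  -- names for the two scales
  set y : ℝ := (n : ℝ) ^ ((1 : ℝ) / 3) with hy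
  have hy0 : 0 ≤ y := Real.rpow_nonneg hn0 _
  set E : ℝ := Real.exp (-(c / 8 * y)) with hE
  have hE0 : 0 < E := Real.exp_pos _
  have hS'pos : (0 : ℝ) < S'.card := lt_of_lt_of_le (mul_pos hE0 hScast) hbS
  have hT'pos : (0 : ℝ) < T'.card := lt_of_lt_of_le (mul_pos hE0 hTcast) hbT
  have hU'pos : (0 : ℝ) < U'.card := lt_of_lt_of_le (mul_pos hE0 hUcast) hbU
  have hS'ne : S'.Nonempty := Finset.card_pos.1 (by exact_mod_cast hS'pos)
  have hT'ne : T'.Nonempty := Finset.card_pos.1 (by exact_mod_cast hT'pos)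
  have hU'ne : U'.Nonempty := Finset.card_pos.1 (by exact_mod_cast hU'pos)
  -- full quotients and the exact count for (S', T', U'): the triple part of the TPP
  have hqST' := card_quot_first hTPP' hU'ne
  have hqTU' : (Finset.image₂ (fun t u => t⁻¹ * u) T' U').card = T'.card * U'.card :=
    card_quot_first (tpp_rotate hTPP') hS'ne
  have hqSU' := card_quot_outer hTPP' hT'ne
  have hcount := h₃ n S' T' U' hTPP'
  -- growth facts at this n
  have hg1 : max C 0 * Real.log n ≤ c / 8 * y := hn₁ n (by omega)
  have hg3 : Real.exp (c * n) ≤ n.factorial := hn₃ n (by omega)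
  have hnC_le : (n : ℝ) ^ C ≤ Real.exp (c / 8 * y) := by
    calc (n : ℝ) ^ C ≤ (n : ℝ) ^ (max C 0) := Real.rpow_le_rpow_of_exponent_le hn1 (le_max_left _ _)
      _ = Real.exp (Real.log n * max C 0) := Real.rpow_def_of_pos (by linarith) _
      _ ≤ Real.exp (c / 8 * y) := Real.exp_le_exp.2 (by rw [mul_comm]; exact hg1)
  have hy_le : y ≤ n := by
    calc y = (n : ℝ) ^ ((1 : ℝ) / 3) := hy
      _ ≤ (n : ℝ) ^ (1 : ℝ) := Real.rpow_le_rpow_of_exponent_le hn1 (by norm_num)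
      _ = n := Real.rpow_one _
  have hW : ((n : ℝ) ^ C) ^ 2 ≤ Real.exp (c / 4 * y) := by
    calc ((n : ℝ) ^ C) ^ 2 ≤ (Real.exp (c / 8 * y)) ^ 2 := by gcongr
      _ = Real.exp (c / 4 * y) := by rw [sq, ← Real.exp_add]; congr 1; ring
  -- the host degree m = n - t is at least n / 2, so m^{1/3} ≥ y / 2
  have htn : t ≤ n := by omega
  have hm : (n : ℝ) / 2 ≤ ((n - t : ℕ) : ℝ) := by
    rw [Nat.cast_sub htn]
    have : (2 * t : ℝ) ≤ n := by exact_mod_cast h2t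
    linarith
  have hm3 : y / 2 ≤ ((n - t : ℕ) : ℝ) ^ ((1 : ℝ) / 3) := by
    have h1 : ((n : ℝ) / 2) ^ ((1 : ℝ) / 3) ≤ ((n - t : ℕ) : ℝ) ^ ((1 : ℝ) / 3) :=
      Real.rpow_le_rpow (by positivity) hm (by norm_num)
    have h2 : ((n : ℝ) / 2) ^ ((1 : ℝ) / 3) = y * (1 / 2) ^ ((1 : ℝ) / 3) := by
      rw [div_eq_mul_one_div, Real.mul_rpow hn0 (by norm_num)]
    have h3 : (1 / 2 : ℝ) ≤ (1 / 2) ^ ((1 : ℝ) / 3) := by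
      have := Real.rpow_le_rpow_of_exponent_ge (x := (1 / 2 : ℝ)) (by norm_num) (by norm_num)
        (show (1 : ℝ) / 3 ≤ 1 by norm_num)
      simpa using this
    calc y / 2 = y * (1 / 2) := by ring
      _ ≤ y * (1 / 2) ^ ((1 : ℝ) / 3) := mul_le_mul_of_nonneg_left h3 hy0
      _ = ((n : ℝ) / 2) ^ ((1 : ℝ) / 3) := h2.symm
      _ ≤ _ := h1
  -- hence the density threshold of the fact inside Stab(L) is below e^{-(c/2) y} · n!
  have hs0 : (0 : ℝ) < (stabFinset L).card := by exact_mod_cast card_stabFinset_pos L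
  have hsle : ((stabFinset L).card : ℝ) ≤ n.factorial := by exact_mod_cast card_stabFinset_le L
  have hthr : Real.exp (-(c * ((n - t : ℕ) : ℝ) ^ ((1 : ℝ) / 3))) *
      (((stabFinset L).card : ℝ) / 2) ≤ Real.exp (-(c / 2 * y)) * n.factorial := by
    have h1 : Real.exp (-(c * ((n - t : ℕ) : ℝ) ^ ((1 : ℝ) / 3))) ≤ Real.exp (-(c / 2 * y)) :=
      Real.exp_le_exp.2 (by have := mul_le_mul_of_nonneg_left hm3 hc.le; linarith)
    have h2 : (((stabFinset L).card : ℝ) / 2) ≤ n.factorial := by linarith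
    exact mul_le_mul h1 h2 (by positivity) (by positivity)
  -- unfold N and (n!)^{3/2} in the slack hypothesis
  have hN : ((S.card * T.card * U.card : ℕ) : ℝ) = (S.card : ℝ) * T.card * U.card := by push_cast; ring
  have hF32 : (n.factorial : ℝ) ^ ((3 : ℝ) / 2) = n.factorial * Real.sqrt n.factorial := by
    rw [Real.sqrt_eq_rpow, ← Real.rpow_one_add' hF0.le (by norm_num)]; norm_num
  rw [hN, hF32] at hlt
  -- each pair product P satisfies n! ≤ P · (n^C)², hence P ≥ e^{-(c/4) y} · n!
  have hsq0 : 0 ≤ ((n : ℝ) ^ C) ^ 2 := by positivity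
  have hpairST : (n.factorial : ℝ) ≤ (S.card : ℝ) * T.card * ((n : ℝ) ^ C) ^ 2 :=
    pair_lower_aux hF0 (by positivity) (by positivity) hsq0 hpSU hpTU hlt (by ring)
  have hpairTU : (n.factorial : ℝ) ≤ (T.card : ℝ) * U.card * ((n : ℝ) ^ C) ^ 2 :=
    pair_lower_aux hF0 (by positivity) (by positivity) hsq0 hpST hpSU hlt (by ring)
  have hpairSU : (n.factorial : ℝ) ≤ (S.card : ℝ) * U.card * ((n : ℝ) ^ C) ^ 2 :=
    pair_lower_aux hF0 (by positivity) (by positivity) hsq0 hpST hpTU hlt (by ring)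
  have hEE : Real.exp (-(c / 2 * y)) * Real.exp (c / 4 * y) = E * E := by
    rw [hE, ← Real.exp_add, ← Real.exp_add]; congr 1; ring
  have hdens : ∀ (P X' Y' x z : ℝ), (n.factorial : ℝ) ≤ P * ((n : ℝ) ^ C) ^ 2 → 0 ≤ P →
      E * x ≤ X' → E * z ≤ Y' → P = x * z → 0 ≤ z → 0 ≤ X' →
      Real.exp (-(c / 2 * y)) * n.factorial ≤ X' * Y' := by
    intro P X' Y' x z hP hP0 hx hz hPxz hz0 hX0
    have h1 : (n.factorial : ℝ) ≤ P * Real.exp (c / 4 * y) :=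
      hP.trans (mul_le_mul_of_nonneg_left hW hP0)
    have h2 : E * x * (E * z) ≤ X' * Y' := mul_le_mul hx hz (mul_nonneg hE0.le hz0) hX0
    calc Real.exp (-(c / 2 * y)) * n.factorial
        ≤ Real.exp (-(c / 2 * y)) * (P * Real.exp (c / 4 * y)) := by gcongr
      _ = (Real.exp (-(c / 2 * y)) * Real.exp (c / 4 * y)) * P := by ring
      _ = E * x * (E * z) := by rw [hEE, hPxz]; ring
      _ ≤ X' * Y' := h2
  have hdA : Real.exp (-(c * ((n - t : ℕ) : ℝ) ^ ((1 : ℝ) / 3))) *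
      (((stabFinset L).card : ℝ) / 2) ≤ ((Finset.image₂ (fun s t => s⁻¹ * t) S' T').card : ℝ) := by
    rw [hqST']; push_cast
    exact hthr.trans (hdens _ _ _ _ _ hpairST (by positivity) hbS hbT rfl hTcast.le hS'pos.le)
  have hdB : Real.exp (-(c * ((n - t : ℕ) : ℝ) ^ ((1 : ℝ) / 3))) *
      (((stabFinset L).card : ℝ) / 2) ≤ ((Finset.image₂ (fun t u => t⁻¹ * u) T' U').card : ℝ) := by
    rw [hqTU']; push_cast
    exact hthr.trans (hdens _ _ _ _ _ hpairTU (by positivity) hbT hbU rfl hUcast.le hT'pos.le)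
  have hdC : Real.exp (-(c * ((n - t : ℕ) : ℝ) ^ ((1 : ℝ) / 3))) *
      (((stabFinset L).card : ℝ) / 2) ≤ ((Finset.image₂ (fun s u => s⁻¹ * u) S' U').card : ℝ) := by
    rw [hqSU']; push_cast
    exact hthr.trans (hdens _ _ _ _ _ hpairSU (by positivity) hbS hbU rfl hUcast.le hS'pos.le)
  -- product mixing relative to Stab(L) against the exact count
  have hM := hmix n t L hL (by omega) _ _ _ heST heTU heSU hgST hgTU hgSU hdA hdB hdC
  clear hmix hgST hgTU hgSU heST heTU heSU hdA hdB hdC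
  rw [hqST', hqTU', hqSU', hcount] at hM
  push_cast at hM
  set N' : ℝ := (S'.card : ℝ) * T'.card * U'.card with hN'
  have hN'pos : 0 < N' := mul_pos (mul_pos hS'pos hT'pos) hU'pos
  have hkey : 0.99 * N' ^ 2 / (((stabFinset L).card : ℝ) / 2) ≤ N' := by
    calc 0.99 * N' ^ 2 / (((stabFinset L).card : ℝ) / 2)
        = 0.99 * ((S'.card : ℝ) * T'.card * (T'.card * U'.card) * (S'.card * U'.card)) /
            (((stabFinset L).card : ℝ) / 2) := by rw [hN']; ring
      _ ≤ _ := hM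
  have h198 : 1.98 * N' ≤ n.factorial := by
    rw [div_le_iff₀ (by positivity)] at hkey
    have : N' * (0.99 * N') ≤ N' * (((stabFinset L).card : ℝ) / 2) := by linarith [hkey]
    have := le_of_mul_le_mul_left this hN'pos
    linarith
  -- budgets: N' ≥ E³ · |S||T||U|
  have hE3 : E ^ 3 * ((S.card : ℝ) * T.card * U.card) ≤ N' := by
    calc E ^ 3 * ((S.card : ℝ) * T.card * U.card) = (E * S.card) * (E * T.card) * (E * U.card) := by ring
      _ ≤ (S'.card : ℝ) * T'.card * U'.card := by
          apply mul_le_mul (mul_le_mul hbS hbT (by positivity) hS'pos.le) hbU (by positivity)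
            (by positivity)
      _ = N' := hN'.symm
  -- the final contradiction: E³ √(n!) < n^C ≤ E³ √(n!)
  have hsqrt : Real.exp (c / 2 * y) ≤ Real.sqrt (n.factorial : ℝ) := by
    calc Real.exp (c / 2 * y) ≤ Real.exp (c * n / 2) :=
          Real.exp_le_exp.2 (by have := mul_le_mul_of_nonneg_left hy_le hc.le; linarith)
      _ = Real.sqrt (Real.exp (c * n)) := Real.exp_half _
      _ ≤ Real.sqrt (n.factorial : ℝ) := Real.sqrt_le_sqrt hg3
  have hlow : (n : ℝ) ^ C ≤ E ^ 3 * Real.sqrt (n.factorial : ℝ) := by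
    calc (n : ℝ) ^ C ≤ Real.exp (c / 8 * y) := hnC_le
      _ = E ^ 3 * Real.exp (c / 2 * y) := by
          rw [hE, ← Real.exp_nat_mul, ← Real.exp_add]; congr 1; push_cast; ring
      _ ≤ E ^ 3 * Real.sqrt (n.factorial : ℝ) := by gcongr
  have hup : E ^ 3 * Real.sqrt (n.factorial : ℝ) * n.factorial < (n : ℝ) ^ C * n.factorial := by
    calc E ^ 3 * Real.sqrt (n.factorial : ℝ) * n.factorial
        = E ^ 3 * (n.factorial * Real.sqrt (n.factorial : ℝ)) := by ring
      _ < E ^ 3 * ((S.card : ℝ) * T.card * U.card * (n : ℝ) ^ C) := by gcongr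
      _ = (E ^ 3 * ((S.card : ℝ) * T.card * U.card)) * (n : ℝ) ^ C := by ring
      _ ≤ N' * (n : ℝ) ^ C := by gcongr
      _ ≤ n.factorial * (n : ℝ) ^ C := by gcongr; linarith
      _ = (n : ℝ) ^ C * n.factorial := by ring
  have := lt_of_mul_lt_mul_right hup hF0.le
  linarith


/-- Wiring check: the registered stubs feed `PolynomialSlack_of` as stated. -/
example : Summit.MatrixMultiplication.MatrixMultiplication.Theses.SnSubsetDichotomy.PolynomialSlack :=
  PolynomialSlack_of stub_klMixing stub_relativeMixing stub_trivialSolutionCount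
    stub_pairwiseGlobalisation

end Summit.MatrixMultiplication.MatrixMultiplication.Cruxes.PolynomialSlack.QuotientGlobalisationByPruning
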